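import Literature.AnabelianGeometry.EtaleTheta.ZHatLevelDetermination
import Mathlib.NumberTheory.Padics.RingHoms
import HarnessLib

/-!
# The `p`-adic cyclotomic character `Ẑ^× = Aut(Ẑ) → ℤ_p^×`

Classical complement to `CyclotomeZHatAction.lean` / `ZHatLevelDetermination.lean`
[RibesZalesskii2010, Thm 2.7.1] (`Ẑ = lim ℤ/nℤ ≅ ∏_ℓ ℤ_ℓ`, `Ẑ^× ≅ ∏_ℓ ℤ_ℓ^×`), over Mathlib's
`ProfiniteGrp.ProfiniteCompletion.completion (GrpCat.of (Multiplicative ℤ))` (= the tree's `SemiGraphs.ZHat` /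
`IUT.HodgeTheaters.ZHat`; the abc-iut cell models `Ẑ^×` as `MulAut ZHat`, [IUTchII] Ex. 1.8 (iii)).
[IUTchII] Example 1.8 (iv) (kurims p. 39) uses "the natural homomorphism `Ẑ^× ↠ ℤ_p^× ↪ Ism`"; this file
CONSTRUCTS its first arrow, the projection of `Ẑ^× = Aut(Ẑ)` onto its `p`-component:

* `ZHatLevel.ppow p k : ℕ+` (`= p^k`) and `ZHatLevel.padicChar p : MulAut Ẑ →* ℤ_[p]` — the `p`-adic
  cyclotomic character, glued (`PadicInt.ofIntSeq`) from the level characters `χ_{p^k} = levelChar (p^k)` of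
  `CyclotomeZHatAction.lean` (compatible by `val_levelChar_mul_mod`); a MONOID homomorphism;
* `ZHatLevel.toZModPow_padicChar` — **characterisation**: `padicChar p φ mod p^k = χ_{p^k}(φ)` for all `k`, and
  `ZHatLevel.eq_padicChar_of_toZModPow` — it is the UNIQUE element of `ℤ_p` with these reductions;
* `ZHatLevel.padicCharUnits p : MulAut Ẑ →* ℤ_[p]ˣ` — the same, valued in units ("`Ẑ^× → ℤ_p^×`"), with
  `coe_padicCharUnits`.

HONEST FRAMING: classical profinite bookkeeping; nothing here bears on [IUTchIII] Cor. 3.12.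
-/

noncomputable section

open CategoryTheory ProfiniteGrp ProfiniteGrp.ProfiniteCompletion

namespace Literature.AnabelianGeometry.EtaleTheta

namespace ZHatLevel

variable (p : ℕ) [hp : Fact p.Prime]

/-- `p^k` as a positive natural number (index of the level characters `χ_{p^k}`).
[cite: RibesZalesskii2010, Thm 2.7.1] -/
abbrev ppow (k : ℕ) : ℕ+ := ⟨p ^ k, pow_pos hp.out.pos k⟩

/-- `(ppow p k : ℕ) = p ^ k`. [cite: RibesZalesskii2010, Thm 2.7.1] -/
@[simp] theorem coe_ppow (k : ℕ) : (ppow p k : ℕ) = p ^ k := rfl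

/-- `ppow p (k + 1) = ppow p k * ppow p 1`. [cite: RibesZalesskii2010, Thm 2.7.1] -/
theorem ppow_succ (k : ℕ) : ppow p (k + 1) = ppow p k * ppow p 1 :=
  PNat.eq (by simp [pow_succ])

/-- The integer sequence `k ↦ χ_{p^k}(φ)` (least non-negative residues) whose `p`-adic limit is the `p`-adic
cyclotomic character of `φ ∈ Aut(Ẑ)`. [cite: RibesZalesskii2010, Thm 2.7.1] -/
def padicCharSeq (φ : MulAut (completion (GrpCat.of (Multiplicative ℤ)))) (k : ℕ) : ℤ :=
  ((levelChar (ppow p k) φ).val : ℤ)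

/-- Compatibility of the sequence: `p^k ∣ χ_{p^{k+1}}(φ) − χ_{p^k}(φ)` (on least residues).
[cite: RibesZalesskii2010, Thm 2.7.1] -/
theorem ppow_dvd_padicCharSeq_succ_sub (φ : MulAut (completion (GrpCat.of (Multiplicative ℤ)))) (k : ℕ) :
    (p : ℤ) ^ k ∣ padicCharSeq p φ (k + 1) - padicCharSeq p φ k := by
  have h := val_levelChar_mul_mod (ppow p k) (ppow p 1) φ
  rw [← ppow_succ] at h
  -- `a % n = b` gives `n ∣ a - b`
  have h' : ((levelChar (ppow p (k + 1)) φ).val : ℤ) % ((p : ℤ) ^ k) =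
      ((levelChar (ppow p k) φ).val : ℤ) := by
    have := congrArg (fun n : ℕ => (n : ℤ)) h
    simpa [coe_ppow, Int.natCast_emod] using this
  rw [padicCharSeq, padicCharSeq, ← h']
  exact ⟨((levelChar (ppow p (k + 1)) φ).val : ℤ) / (p : ℤ) ^ k, by
    linarith [Int.mul_ediv_add_emod ((levelChar (ppow p (k + 1)) φ).val : ℤ) ((p : ℤ) ^ k)]⟩

/-- The underlying function of the `p`-adic cyclotomic character: the `p`-adic integer with reductions
`χ_{p^k}(φ)`. [cite: RibesZalesskii2010, Thm 2.7.1] -/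
def padicCharFun (φ : MulAut (completion (GrpCat.of (Multiplicative ℤ)))) : ℤ_[p] :=
  PadicInt.ofIntSeq _
    (PadicInt.isCauSeq_padicNorm_of_pow_dvd_sub (padicCharSeq p φ) p (ppow_dvd_padicCharSeq_succ_sub p φ))

/-- Reductions of `padicCharFun`: `mod p^k` it is `χ_{p^k}(φ)`. [cite: RibesZalesskii2010, Thm 2.7.1] -/
theorem toZModPow_padicCharFun (φ : MulAut (completion (GrpCat.of (Multiplicative ℤ)))) (k : ℕ) :
    PadicInt.toZModPow k (padicCharFun p φ) = (levelChar (ppow p k) φ : ZMod (p ^ k)) := by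
  haveI : NeZero (p ^ k) := ⟨pow_ne_zero k hp.out.ne_zero⟩
  rw [padicCharFun, PadicInt.toZModPow_ofIntSeq_of_pow_dvd_sub (padicCharSeq p φ) p
    (ppow_dvd_padicCharSeq_succ_sub p φ) k, padicCharSeq, Int.cast_natCast]
  exact ZMod.natCast_zmod_val (levelChar (ppow p k) φ)

/-- **The `p`-adic cyclotomic character `χ_p : Ẑ^× = Aut(Ẑ) → ℤ_p`**, a monoid homomorphism (the first arrow
of "the natural homomorphism `Ẑ^× ↠ ℤ_p^× ↪ Ism`" of [IUTchII] Ex. 1.8 (iv) p. 39): the `p`-adic integer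
whose reduction mod `p^k` is the level character `χ_{p^k}` for every `k`. [cite: RibesZalesskii2010, Thm 2.7.1] -/
def padicChar : MulAut (completion (GrpCat.of (Multiplicative ℤ))) →* ℤ_[p] where
  toFun := padicCharFun p
  map_one' := PadicInt.ext_of_toZModPow.mp fun k => by
    rw [toZModPow_padicCharFun, map_one, map_one]
    rfl
  map_mul' φ ψ := PadicInt.ext_of_toZModPow.mp fun k => by
    rw [toZModPow_padicCharFun, map_mul, map_mul, toZModPow_padicCharFun, toZModPow_padicCharFun]
    rfl

/-- **Characterisation**: `χ_p(φ) mod p^k = χ_{p^k}(φ)`. [cite: RibesZalesskii2010, Thm 2.7.1] -/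
theorem toZModPow_padicChar (φ : MulAut (completion (GrpCat.of (Multiplicative ℤ)))) (k : ℕ) :
    PadicInt.toZModPow k (padicChar p φ) = (levelChar (ppow p k) φ : ZMod (p ^ k)) :=
  toZModPow_padicCharFun p φ k

/-- **Uniqueness**: a `p`-adic integer with reductions `χ_{p^k}(φ)` for all `k` IS `χ_p(φ)`.
[cite: RibesZalesskii2010, Thm 2.7.1] -/
theorem eq_padicChar_of_toZModPow {φ : MulAut (completion (GrpCat.of (Multiplicative ℤ)))} {a : ℤ_[p]}
    (h : ∀ k : ℕ, PadicInt.toZModPow k a = (levelChar (ppow p k) φ : ZMod (p ^ k))) : a = padicChar p φ :=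
  PadicInt.ext_of_toZModPow.mp fun k => by rw [h k, toZModPow_padicChar]

/-- `χ_p(φ) · χ_p(φ⁻¹) = 1`: the character takes values in units. [cite: RibesZalesskii2010, Thm 2.7.1] -/
theorem padicChar_mul_padicChar_inv (φ : MulAut (completion (GrpCat.of (Multiplicative ℤ)))) :
    padicChar p φ * padicChar p φ⁻¹ = 1 := by
  rw [← map_mul, mul_inv_cancel, map_one]

/-- `χ_p(φ)` is a unit of `ℤ_p`. [cite: RibesZalesskii2010, Thm 2.7.1] -/
theorem isUnit_padicChar (φ : MulAut (completion (GrpCat.of (Multiplicative ℤ)))) : IsUnit (padicChar p φ) :=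
  IsUnit.of_mul_eq_one _ (padicChar_mul_padicChar_inv p φ)

/-- **`Ẑ^× → ℤ_p^×`**: the `p`-adic cyclotomic character valued in the units of `ℤ_p` (the first arrow of
[IUTchII] Ex. 1.8 (iv)'s "`Ẑ^× ↠ ℤ_p^× ↪ Ism`"). [cite: RibesZalesskii2010, Thm 2.7.1] -/
def padicCharUnits : MulAut (completion (GrpCat.of (Multiplicative ℤ))) →* ℤ_[p]ˣ :=
  (padicChar p).toHomUnits

/-- The unit `padicCharUnits p φ` has underlying element `χ_p(φ)`. [cite: RibesZalesskii2010, Thm 2.7.1] -/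
@[simp] theorem coe_padicCharUnits (φ : MulAut (completion (GrpCat.of (Multiplicative ℤ)))) :
    ((padicCharUnits p φ : ℤ_[p]ˣ) : ℤ_[p]) = padicChar p φ := rfl

end ZHatLevel

end Literature.AnabelianGeometry.EtaleTheta

end
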